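import Literature.MathematicalPhysics.QuantumFieldTheory.Federbush1986.AxialTreeLipschitz

/-!
# `Federbush1986.PathAveragingIterated` — [Federbush1986PhaseCellI] (1.11) p. 323–324 «By iterating we obtain a similar formula
# for A_Γ as an average over paths in ℒ^s, s > r, A_Γ = (1/2^{4(s−r)}) Σ_α A_{Γ̂_α}. (1.11) Here α is summed over vertices in a
# superblock with base point A. Γ̂_α is a union of Γ_α and paths in the two superblocks associated to A and B. … The only fact
# we here need is that if Γ has n edges in ℒ^r, then Γ̂_α in ℒ^s has ≤ (n + c)2^{s−r} edges. This may be shown by induction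
# from the considerations leading to (1.10).» — THE ITERATED PATH-AVERAGING IDENTITY (1.11) AND THE EDGE COUNT, PROVED for the
# concrete Bałaban averaging `axialTreeAveraging` (row F1.Eq1.10-1.11; member of that row next to `AxialTree.evalSteps_avStep` = (1.10))

statement-level skeleton of published theorems with citation tags; proofs where landed; nothing here is a claim about the Yang–Mills mass gap

CITATION HEADER.  P. Federbush, *A phase cell approach to Yang–Mills theory. I. Modes, lattice-continuum duality*, Commun.
Math. Phys. **107** (1986) 319–329, doi:10.1007/bf01209397 [Federbush1986PhaseCellI] (lit store `paper:url-fbe4197787cb`,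
journal page = PDF page + 318; pp. 323–324 READ AS IMAGES, renders `run/shared/lean/pub/pub-balaban/t4/b2b-balaban-t4-lit2/
renders/fed1986/fed1986-cmp107-p005-x2.png` (p. 323: (1.10), (1.11)) and `run/shared/lean/pub/lit-balaban/lit-balaban-r17/renders/
fedI/fed1986-cmp107-p006-x2.png` (p. 324: the superblock sentence and the edge count)).  Unit `lit-balaban-r17` gen 57 (Federbush
fold owner; owner self-audit of row **F1.Eq1.10-1.11** under the lead's READING RULE FOR DEFINITION DISPLAYS, HOME/STATUS
2026-08-23T07:00:05Z).  HOME `run/shared/lean/pub/lit-balaban/` (seat dir `lit-balaban-r17/`).  Imports `AxialTreeLipschitz`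
(p244780: the path functionals `AxialTree.evalSteps`, the lifted path `AxialTree.lift` = Γ̂_δ, the one-step identity
`AxialTree.evalSteps_avStep` = (1.10), `AxialTree.length_lift`); nothing of it is restated.

WHAT IS PRINTED (verbatim, p. 323–324).  «Let Γ be an oriented path in ℒ^r joining vertices A and B. … We then have
A_Γ = (1/2⁴) Σ_α A_{Γ̂_α} (1.10) (where on the left side assignments are from ℒ^r, on the right side from ℒ^{r+1}). By iterating
we obtain a similar formula for A_Γ as an average over paths in ℒ^s, s > r, A_Γ = (1/2^{4(s−r)}) Σ_α A_{Γ̂_α}. (1.11) Here α is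
summed over vertices in a superblock with base point A. Γ̂_α is a union of Γ_α and paths in the two superblocks associated to A
and B. The paths in the superblocks are pleasant to analyze, we leave this to the reader. The only fact we here need is that if
Γ has n edges in ℒ^r, then Γ̂_α in ℒ^s has ≤ (n + c)2^{s−r} edges. This may be shown by induction from the considerations
leading to (1.10).»

WHAT THIS MODULE PROVES (for the concrete averaging with the axial maximal trees, `AxialTree.avStep` / `axialTreeAveraging`,
exactly as the accepted one-step identity (1.10) `AxialTree.evalSteps_avStep`; no `Prop`-valued definition, no new named fact):
* `AxialTree.iterLift k δs Γ` — the `k`-fold lifted path `Γ̂_α` for the superblock index `α = (δ₁, …, δ_k) ∈ ({0,1}⁴)^k` (the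
  lift of (1.10) iterated: «Γ̂_α is a union of Γ_α and paths in the two superblocks associated to A and B»), and
  `AxialTree.twicePow k v = 2^k·v` (the base point `A` read in `ℒ^{r+k}`);
* `AxialTree.card_superblockIndex` — the index set has `2^{4k}` elements («2^{4(s−r)} vertices in the superblock», p. 322);
* **`AxialTree.evalSteps_avStep_iterate`** — (1.11): `A_Γ(avStep^[k] f) = (1/16)^k Σ_α A_{Γ̂_α}(f)`, for every path and every `k`;
* **`AxialTree.length_iterLift_le`** — the edge count: `|Γ̂_α| ≤ (n + 8)·2^k − 8 ≤ (n + c)2^k` with `c = 8`, by induction from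
  `length_lift` («This may be shown by induction from the considerations leading to (1.10)»);
* `axialTreeAveraging_evalSteps_av` / `axialTreeAveraging_av_apply_eq_sum` — (1.11) for the inhabitant `axialTreeAveraging.av s r`
  (`s ≤ r`, `k = r − s`): every path functional, in particular every single bond variable, of the level-`s` average is the mean
  over the `2^{4(r−s)}` lifted paths of the level-`r` assignment.
-/

namespace Literature.MathematicalPhysics.QuantumFieldTheory.Federbush1986

noncomputable section

open scoped BigOperators

namespace AxialTree

/-! ## The superblock index, the base point in `ℒ^{r+k}` and the iterated lift `Γ̂_α` -/

/-- The base point `A` of `ℒ^r` read `k` levels down, in the integer coordinates of `ℒ^{r+k}`: `2^k·v` (the base point of the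
«superblock» obtained by the «cascade process», p. 322). [cite: Federbush1986PhaseCellI, §1 p. 322, (1.11) p. 323–324] -/
def twicePow (k : ℕ) (v : Fin 4 → ℤ) : Fin 4 → ℤ := twice^[k] v

/-- `twicePow 0 = id`. [cite: Federbush1986PhaseCellI, (1.11) p. 323–324] -/
@[simp] theorem twicePow_zero (v : Fin 4 → ℤ) : twicePow 0 v = v := rfl

/-- One more level: `twicePow (k+1) v = twicePow k (2v)`. [cite: Federbush1986PhaseCellI, (1.11) p. 323–324] -/
theorem twicePow_succ (k : ℕ) (v : Fin 4 → ℤ) : twicePow (k + 1) v = twicePow k (twice v) := by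
  simp [twicePow, Function.iterate_succ_apply]

/-- Coordinates: `(twicePow k v)_i = 2^k · v_i`. [cite: Federbush1986PhaseCellI, §1 p. 322] -/
theorem twicePow_apply (k : ℕ) : ∀ (v : Fin 4 → ℤ) (i : Fin 4), twicePow k v i = 2 ^ k * v i := by
  induction k with
  | zero => intro v i; simp
  | succ k ih => intro v i; rw [twicePow_succ, ih, pow_succ]; simp [twice]; ring

/-- The `k`-fold LIFTED PATH `Γ̂_α`, `α = (δ₁, …, δ_k)`: lift by `δ₁` (tree leg up in the block of the start vertex, every step
doubled, tree leg down in the block of the end vertex — `AxialTree.lift`, (1.10)), then lift the result by `δ₂`, and so on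
(«Γ̂_α is a union of Γ_α and paths in the two superblocks associated to A and B», p. 324).
[cite: Federbush1986PhaseCellI, (1.10)–(1.11) p. 323–324] -/
def iterLift : (k : ℕ) → (Fin k → (Fin 4 → Bool)) → List (Fin 4 × Bool) → List (Fin 4 × Bool)
  | 0, _, steps => steps
  | k + 1, δs, steps => iterLift k (Fin.tail δs) (lift (δs 0) steps)

/-- `iterLift 0` is the path itself. [cite: Federbush1986PhaseCellI, (1.11) p. 323–324] -/
@[simp] theorem iterLift_zero (δs : Fin 0 → (Fin 4 → Bool)) (steps : List (Fin 4 × Bool)) : iterLift 0 δs steps = steps := rfl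

/-- Unfolding one level of `iterLift`. [cite: Federbush1986PhaseCellI, (1.10)–(1.11) p. 323–324] -/
theorem iterLift_succ (k : ℕ) (δs : Fin (k + 1) → (Fin 4 → Bool)) (steps : List (Fin 4 × Bool)) :
    iterLift (k + 1) δs steps = iterLift k (Fin.tail δs) (lift (δs 0) steps) := rfl

/-- «there are 2^{4(s−r)} vertices in ℒ^s, s > r, associated to v, the vertices in a "superblock"» (p. 322): the superblock index
set `({0,1}⁴)^k` has `2^{4k}` elements. [cite: Federbush1986PhaseCellI, §1 p. 322, (1.11) p. 324] -/
theorem card_superblockIndex (k : ℕ) : Fintype.card (Fin k → (Fin 4 → Bool)) = 2 ^ (4 * k) := by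
  simp [pow_mul]

/-! ## (1.11): the iterated identity -/

/-- **(1.11)** «By iterating we obtain a similar formula for A_Γ as an average over paths in ℒ^s, s > r, A_Γ = (1/2^{4(s−r)})
Σ_α A_{Γ̂_α}» — for the axial-tree averaging: the functional of ANY lattice path `Γ = (v, steps)` on the `k`-fold average
`avStep^[k] f` is the mean over the `2^{4k}` superblock indices `α` of the functionals of the lifted paths `Γ̂_α` (started at the
base point `2^k v`) on `f`. [cite: Federbush1986PhaseCellI, (1.11) p. 323–324] -/
theorem evalSteps_avStep_iterate (f : Cfg) :
    ∀ (k : ℕ) (v : Fin 4 → ℤ) (steps : List (Fin 4 × Bool)),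
      evalSteps (avStep^[k] f) v steps =
        (1 / 16 : ℝ) ^ k * ∑ δs : Fin k → (Fin 4 → Bool), evalSteps f (twicePow k v) (iterLift k δs steps) := by
  intro k
  induction k with
  | zero => intro v steps; simp
  | succ k ih =>
    intro v steps
    rw [Function.iterate_succ_apply', evalSteps_avStep]
    -- each one-step lift is averaged further by the induction hypothesis
    have hterm : ∀ δ : Fin 4 → Bool, evalSteps (avStep^[k] f) (twice v) (lift δ steps) =
        (1 / 16 : ℝ) ^ k * ∑ δs : Fin k → (Fin 4 → Bool),
          evalSteps f (twicePow k (twice v)) (iterLift k δs (lift δ steps)) := fun δ => ih (twice v) (lift δ steps)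
    simp only [hterm, Finset.mul_sum]
    -- re-index the double sum over (δ, δs) by the superblock index Fin (k+1) → {0,1}⁴ via `Fin.cons`
    rw [show (∑ δs : Fin (k + 1) → (Fin 4 → Bool),
          (1 / 16 : ℝ) ^ (k + 1) * evalSteps f (twicePow (k + 1) v) (iterLift (k + 1) δs steps))
        = ∑ p : (Fin 4 → Bool) × (Fin k → (Fin 4 → Bool)),
          (1 / 16 : ℝ) ^ (k + 1) * evalSteps f (twicePow (k + 1) v) (iterLift (k + 1) (Fin.cons p.1 p.2) steps) from ?_]
    · rw [Fintype.sum_prod_type]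
      refine Finset.sum_congr rfl (fun δ _ => Finset.sum_congr rfl (fun δs _ => ?_))
      rw [iterLift_succ, Fin.cons_zero, Fin.tail_cons, twicePow_succ]
      ring
    · exact (Fintype.sum_equiv (Fin.consEquiv fun _ : Fin (k + 1) => (Fin 4 → Bool)) _ _ (fun _ => rfl)).symm

/-! ## The edge count «≤ (n + c)2^{s−r}» -/

/-- **The edge count of (1.11)** «if Γ has n edges in ℒ^r, then Γ̂_α in ℒ^s has ≤ (n + c)2^{s−r} edges. This may be shown by
induction from the considerations leading to (1.10)» — by induction from `length_lift` (`|Γ̂_δ| ≤ 2|Γ| + 8`):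
`|Γ̂_α| + 8 ≤ (n + 8)·2^k`, i.e. `c = 8` for the axial trees. [cite: Federbush1986PhaseCellI, (1.11) p. 324] -/
theorem length_iterLift_add_le :
    ∀ (k : ℕ) (δs : Fin k → (Fin 4 → Bool)) (steps : List (Fin 4 × Bool)),
      (iterLift k δs steps).length + 8 ≤ (steps.length + 8) * 2 ^ k := by
  intro k
  induction k with
  | zero => intro δs steps; simp
  | succ k ih =>
    intro δs steps
    rw [iterLift_succ]
    have h1 := ih (Fin.tail δs) (lift (δs 0) steps)
    have h2 := length_lift (δs 0) steps
    calc (iterLift k (Fin.tail δs) (lift (δs 0) steps)).length + 8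
        ≤ ((lift (δs 0) steps).length + 8) * 2 ^ k := h1
      _ ≤ (2 * steps.length + 8 + 8) * 2 ^ k := Nat.mul_le_mul_right _ (by omega)
      _ = (steps.length + 8) * 2 ^ (k + 1) := by ring

/-- The edge count in the printed shape `≤ (n + c)2^{s−r}` with `c = 8` (and the sharper `(n + 8)2^k − 8`).
[cite: Federbush1986PhaseCellI, (1.11) p. 324] -/
theorem length_iterLift_le (k : ℕ) (δs : Fin k → (Fin 4 → Bool)) (steps : List (Fin 4 × Bool)) :
    (iterLift k δs steps).length ≤ (steps.length + 8) * 2 ^ k - 8 ∧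
      (iterLift k δs steps).length ≤ (steps.length + 8) * 2 ^ k := by
  have h := length_iterLift_add_le k δs steps
  omega

end AxialTree

/-! ## (1.11) for the inhabitant `axialTreeAveraging` -/

open AxialTree

/-- A single forward step evaluates the bond variable. [cite: Federbush1986PhaseCellI, §1 p. 322] -/
theorem AxialTree.evalSteps_single_step (F : Cfg) (b : Fin 4 → ℤ) (μ : Fin 4) :
    evalSteps F b [(μ, true)] = F b μ := by
  simp [evalSteps, sgnR, edgeBase]

/-- **(1.11) at the level of the carrier**: for `s ≤ r`, every path functional of the level-`s` Bałaban average
`axialTreeAveraging.av s r a` of a level-`r` assignment `a` is the mean over the `2^{4(r−s)}` superblock indices of the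
functionals of the lifted paths on `a` («where on the left side assignments are from ℒ^s, on the right side from ℒ^r»).
[cite: Federbush1986PhaseCellI, (1.10)–(1.11) p. 323–324] -/
theorem axialTreeAveraging_evalSteps_av {s r : ℕ} (h : s ≤ r) (a : Edge r → ℝ) (v : Fin 4 → ℤ)
    (steps : List (Fin 4 × Bool)) :
    evalSteps (toCfg (axialTreeAveraging.av s r a)) v steps =
      (1 / 16 : ℝ) ^ (r - s) * ∑ δs : Fin (r - s) → (Fin 4 → Bool),
        evalSteps (toCfg a) (twicePow (r - s) v) (iterLift (r - s) δs steps) := by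
  rw [axialTreeAveraging_av_of_le h, toCfg_ofCfg, evalSteps_avStep_iterate]

/-- **(1.11) for a single bond** (Γ = one edge, n = 1): the level-`s` bond variable `A(e)` of the average is the mean over
`α` of the functionals `A_{Γ̂_α}` of the level-`r` assignment, the lifted paths having `≤ 9·2^{r−s} − 8` edges.
[cite: Federbush1986PhaseCellI, (1.1) p. 322, (1.10)–(1.11) p. 323–324] -/
theorem axialTreeAveraging_av_apply_eq_sum {s r : ℕ} (h : s ≤ r) (a : Edge r → ℝ) (e : Edge s) :
    axialTreeAveraging.av s r a e =
      (1 / 16 : ℝ) ^ (r - s) * ∑ δs : Fin (r - s) → (Fin 4 → Bool),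
        evalSteps (toCfg a) (twicePow (r - s) e.base) (iterLift (r - s) δs [(e.dir, true)]) ∧
    ∀ δs : Fin (r - s) → (Fin 4 → Bool), (iterLift (r - s) δs [(e.dir, true)]).length ≤ 9 * 2 ^ (r - s) - 8 := by
  refine ⟨?_, fun δs => ?_⟩
  · have := axialTreeAveraging_evalSteps_av h a e.base [(e.dir, true)]
    rw [evalSteps_single_step] at this
    cases e
    exact this
  · have := (length_iterLift_le (r - s) δs [(e.dir, true)]).1
    simpa using this

end

end Literature.MathematicalPhysics.QuantumFieldTheory.Federbush1986
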